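import Summits.ResolutionOfSingularities.ResolutionOfSingularities.Theorems.PurelyInseparableDim4NarrowApolarity
import Summits.ResolutionOfSingularities.ResolutionOfSingularities.Theorems.PurelyInseparableDim4JetColength
import HarnessLib

/-!
# The NARROW LINE of the ridge trichotomy — idea-3's stub `NarrowCurvilinear`, literal text (cell `res-dim4-pi`)

[OURS · counted 0 · elementary commutative algebra over the TREE's vocabulary; nothing here is a
statement of any manuscript and nothing here proves resolution of singularities in dimension ≥ 4 /
characteristic `p`.]  Continuation of `PurelyInseparableDim4NarrowApolarity` (L0/L1a/L1♭, this seat)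
and `PurelyInseparableDim4JetColength` §5 (L1(c) `RidgeBudget.X_pow_jetColength_mem`, seat p-3 g2).

* `originIdeal_le_sup_iff`: at a point of order `q ≥ 2`, `𝔪₀ ≤ J_q⁺(F) ⊔ 𝔪₀² ⟺ A(in F) = 0` (both
  halves of the apolarity file together).
* `narrowCurvilinear` — the literal text of idea-3's stub `RidgeBudget.NarrowCurvilinear p q`
  (`HOME/res-dim4-idea-3/lean/NarrowLine.lean` 12405623f2353fc4, CARD I-3-10, not in the tree),
  unfolded, for every `p` and every order `q ≥ 2` over every field: conjunct 1 is
  `NarrowApolarity.originIdeal_le_span_X_sup`, conjunct 2 is `RidgeBudget.X_pow_jetColength_mem`.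

bears_on: LADDER-RESOLUTION:D157-DOOR2 (res-dim4-pi · F4-I(p,p) narrow branch · L1).  Seat res-dim4-p-1 g2
(desk WORD #43).  Supports stmt-ResolutionOfSingularities-16155 (helper).
-/

set_option linter.dupNamespace false

noncomputable section

namespace Summit.ResolutionOfSingularities.ResolutionOfSingularities.Theorems.PIDim4

namespace NarrowApolarity

open MvPolynomial Finset
open Literature.AlgebraicGeometry.Resolution
open Literature.AlgebraicGeometry.Resolution.Hauser2010
open Literature.AlgebraicGeometry.Resolution.HauserPerlega2019
open PointBlowup (additiveSubspace polarMap)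

variable {K : Type} [Field K]

/-- The two directions together: at a point of order `q ≥ 2`, **`𝔪₀ ≤ J_q⁺(F) ⊔ 𝔪₀²` iff `ē = 0`**.
[OURS · L0′ of CARD I-3-10] [cite: BerthomieuHivertMourtada2010, Cor. 2.3] -/
theorem originIdeal_le_sup_iff {q : ℕ} (hq : 2 ≤ q) {F : MvPolynomial (Fin 4) K}
    (hord : ordZero F = q) :
    originIdeal K ≤ singLocusIdeal q F ⊔ originIdeal K ^ 2 ↔ additiveSubspace (initialForm F) = ⊥ :=
  ⟨fun h => by
    by_contra hne
    exact not_originIdeal_le_sup hord hne h,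
   originIdeal_le_sup_of_additiveSubspace_eq_bot hq hord⟩

/-- **idea-3's stub `RidgeBudget.NarrowCurvilinear p q`, literal text** (`NarrowLine.lean`
12405623f2353fc4 §L1, with `ebar`/`IsCert`/`jetColength` of `…RidgeBudget`), proved for every `p`
and every order `q ≥ 2` over every field (the characteristic hypothesis is not used): at a state of
order `q` with a one-dimensional ridge `K·w` and a certificate at level `N`, for every coordinate
`x_j` with `w_j ≠ 0`: `𝔪₀ ≤ (x_j) ⊔ J_q⁺(F) ⊔ 𝔪₀²` and `x_j^{μ⁺(F)} ∈ J_q⁺(F) ⊔ 𝔪₀ᴹ` for every `M`.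
[OURS · L1 of CARD I-3-10] [cite: BerthomieuHivertMourtada2010, Cor. 2.3] -/
theorem narrowCurvilinear (p q : ℕ) (hq : 2 ≤ q) :
    ∀ (K : Type) [Field K] [CharP K p] [DecidableEq K] (F : MvPolynomial (Fin 4) K) (N : ℕ)
      (w : Fin 4 → K) (j : Fin 4),
      ordZero F = q → RidgeBudget.ebar F = 1 → RidgeBudget.IsCert q N F →
        w ∈ additiveSubspace (initialForm F) → w j ≠ 0 →
          originIdeal K ≤ Ideal.span {(X j : MvPolynomial (Fin 4) K)} ⊔ singLocusIdeal q F ⊔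
              originIdeal K ^ 2 ∧
            ∀ M : ℕ, (X j : MvPolynomial (Fin 4) K) ^ RidgeBudget.jetColength q N F ∈
              singLocusIdeal q F ⊔ originIdeal K ^ M :=
  fun _K _ _ _ _F _N _w j hord hē hN hw hwj =>
    ⟨originIdeal_le_span_X_sup hq hord hē hw hwj, fun M => RidgeBudget.X_pow_jetColength_mem hN j M⟩

/-- The prime-order instance: `NarrowCurvilinear p p` (literal text) for every prime `p`.
[OURS · L1 of CARD I-3-10] [cite: BerthomieuHivertMourtada2010, Cor. 2.3] -/
theorem narrowCurvilinear_prime (p : ℕ) [hp : Fact p.Prime] :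
    ∀ (K : Type) [Field K] [CharP K p] [DecidableEq K] (F : MvPolynomial (Fin 4) K) (N : ℕ)
      (w : Fin 4 → K) (j : Fin 4),
      ordZero F = p → RidgeBudget.ebar F = 1 → RidgeBudget.IsCert p N F →
        w ∈ additiveSubspace (initialForm F) → w j ≠ 0 →
          originIdeal K ≤ Ideal.span {(X j : MvPolynomial (Fin 4) K)} ⊔ singLocusIdeal p F ⊔
              originIdeal K ^ 2 ∧
            ∀ M : ℕ, (X j : MvPolynomial (Fin 4) K) ^ RidgeBudget.jetColength p N F ∈
              singLocusIdeal p F ⊔ originIdeal K ^ M :=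
  narrowCurvilinear p p hp.out.two_le

end NarrowApolarity

end Summit.ResolutionOfSingularities.ResolutionOfSingularities.Theorems.PIDim4

end
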